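import Mathlib
import Summits.Ventures.HodgeRepro2.T5ProfiniteDistributionConvolution
import Summits.Ventures.HodgeRepro2.T5ProfiniteDistributionLimit

/-!
# T5ProfiniteDistributionAlgebra — the bounded measures on a presented compact abelian group
form a commutative ring under convolution, `coord` is multiplicative, and the μ-invariant is
super-additive: `W[[Γ]]` AS A RING

Tier-5 support for route-3's §G (route/T5-CHECK-G-p7.md §3 S5, §21.4): the print's
`Λ = W[[Γ⁻]]` is a commutative ring and `ℒ⁻_{χ,Σ}` an element of it.  With
T5ProfiniteDistributionConvolution's convolution and T5ProfiniteDistributionDirac's unit: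

* `conv_assoc` — associativity, directly (`shift_add_shift`: `f((x + y) + ·) = f(x + (y + ·))`);
* `conv_add_left` / `conv_add_right` / `conv_smul_left` / `conv_smul_right` — bilinearity;
* **`conv_comm`** — commutativity, through the coordinates: `coord (m₁ ∗ m₂) = levelMul … = coord (m₂ ∗ m₁)`
  and a bounded measure is its coordinates (the Fubini step of the model);
* **`convCommRing P hq : CommRing (boundedMeasures X A)`** — the bounded measures with
  `+`, `∗`, unit `δ_0`, for a presentation with additive level maps;
* **`coord_mul`** — `coord (m₁ ∗ m₂) = levelMul (coord m₁) (coord m₂)` on the ring: the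
  coordinates are a ring homomorphism onto the level-wise group rings — `W[[Γ⁻]] = lim_k W[Γ⁻/p^kΓ⁻]`
  with its ring structure, for `Γ⁻ ≅ ℤ_p^ι` through `padicProductPresentation` (`convCommRing_product`);
* the μ-INVARIANT against the convolution, for `W`-valued measures: **`muV_conv_ge`**
  (`μ(m₁) + μ(m₂) ≤ μ(m₁ ∗ m₂)` — the coordinates of the convolution are the group-ring products,
  and the valuation of a sum of products is at least the minimum of the sums), `muV_dirac`
  (`μ(δ_x) = 0`), **`muV_conv_dirac`** (`μ(δ_x ∗ m) = μ(m)`: translation permutes the coordinates).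

No printed input is consumed.  §8(d): uses an L-value-free non-vanishing device: NO.
-/

namespace Summit.Ventures.HodgeRepro2.T5ProfiniteDistributionAlgebra

open Summit.Ventures.HodgeRepro2.T5ProfiniteDistribution
open Summit.Ventures.HodgeRepro2.T5MeasureSupOnClopens (indicatorCM indicatorCM_apply)
open Summit.Ventures.HodgeRepro2.T5ProfiniteDistributionPadic
open Summit.Ventures.HodgeRepro2.T5ProfiniteDistributionConvolution
open Summit.Ventures.HodgeRepro2.T5MuInvariantDVR
open IsDiscreteValuationRing (addVal)
open Summit.Ventures.HodgeRepro2.T5ProfiniteDistributionLimit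
open Finset

universe u v

section Assoc

variable {X : Type u} [NormedAddCommGroup X] [CompactSpace X] {A : Type*} [NormedCommRing A]

omit [CompactSpace X] in
/-- `f((x + y) + ·) = (f(x + ·))(y + ·)`. -/
theorem shift_add_shift (x y : X) (f : C(X, A)) : shift (x + y) f = shift y (shift x f) := by
  ext z
  simp only [shift_apply, add_assoc]

/-- The translate of a partial integral is the partial integral of the translate. -/
theorem shift_partialIntegral (m₃ : C(X, A) →ₗ[A] A) {C₃ : ℝ}
    (hm₃ : ∀ φ : C(X, A), ‖m₃ φ‖ ≤ C₃ * ‖φ‖) (x : X) (f : C(X, A)) :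
    shift x (partialIntegral m₃ hm₃ f) = partialIntegral m₃ hm₃ (shift x f) := by
  ext y
  rw [shift_apply, partialIntegral_apply, partialIntegral_apply, shift_add_shift]

/-- ASSOCIATIVITY of the convolution: `(m₁ ∗ m₂) ∗ m₃ = m₁ ∗ (m₂ ∗ m₃)`. -/
theorem conv_assoc (m₁ m₂ m₃ : C(X, A) →ₗ[A] A) {C₂ C₃ : ℝ} (hC₂ : 0 ≤ C₂) (hC₃ : 0 ≤ C₃)
    (hm₂ : ∀ φ : C(X, A), ‖m₂ φ‖ ≤ C₂ * ‖φ‖) (hm₃ : ∀ φ : C(X, A), ‖m₃ φ‖ ≤ C₃ * ‖φ‖) :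
    conv (conv m₁ m₂ hm₂) m₃ hm₃ = conv m₁ (conv m₂ m₃ hm₃) (norm_conv_le m₂ m₃ hC₂ hC₃ hm₂ hm₃) := by
  ext f
  show m₁ (partialIntegral m₂ hm₂ (partialIntegral m₃ hm₃ f)) =
    m₁ (partialIntegral (conv m₂ m₃ hm₃) (norm_conv_le m₂ m₃ hC₂ hC₃ hm₂ hm₃) f)
  congr 1
  ext x
  simp only [partialIntegral_apply, conv_apply, shift_partialIntegral]

/-- Bilinearity: `(m₁ + m₁') ∗ m₂ = m₁ ∗ m₂ + m₁' ∗ m₂`. -/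
theorem conv_add_left (m₁ m₁' m₂ : C(X, A) →ₗ[A] A) {C₂ : ℝ}
    (hm₂ : ∀ φ : C(X, A), ‖m₂ φ‖ ≤ C₂ * ‖φ‖) :
    conv (m₁ + m₁') m₂ hm₂ = conv m₁ m₂ hm₂ + conv m₁' m₂ hm₂ := by
  ext f
  simp only [conv_apply, LinearMap.add_apply]

/-- Bilinearity: `m₁ ∗ (m₂ + m₂') = m₁ ∗ m₂ + m₁ ∗ m₂'`. -/
theorem conv_add_right (m₁ m₂ m₂' : C(X, A) →ₗ[A] A) {C₂ C₂' C : ℝ}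
    (hm₂ : ∀ φ : C(X, A), ‖m₂ φ‖ ≤ C₂ * ‖φ‖) (hm₂' : ∀ φ : C(X, A), ‖m₂' φ‖ ≤ C₂' * ‖φ‖)
    (h : ∀ φ : C(X, A), ‖(m₂ + m₂') φ‖ ≤ C * ‖φ‖) :
    conv m₁ (m₂ + m₂') h = conv m₁ m₂ hm₂ + conv m₁ m₂' hm₂' := by
  ext f
  simp only [conv_apply, LinearMap.add_apply]
  rw [← map_add]
  rfl

/-- `(c • m₁) ∗ m₂ = c • (m₁ ∗ m₂)`. -/
theorem conv_smul_left (c : A) (m₁ m₂ : C(X, A) →ₗ[A] A) {C₂ : ℝ}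
    (hm₂ : ∀ φ : C(X, A), ‖m₂ φ‖ ≤ C₂ * ‖φ‖) :
    conv (c • m₁) m₂ hm₂ = c • conv m₁ m₂ hm₂ := by
  ext f
  simp only [conv_apply, LinearMap.smul_apply]

/-- `m₁ ∗ (c • m₂) = c • (m₁ ∗ m₂)`. -/
theorem conv_smul_right (c : A) (m₁ m₂ : C(X, A) →ₗ[A] A) {C₂ C : ℝ}
    (hm₂ : ∀ φ : C(X, A), ‖m₂ φ‖ ≤ C₂ * ‖φ‖)
    (h : ∀ φ : C(X, A), ‖(c • m₂) φ‖ ≤ C * ‖φ‖) :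
    conv m₁ (c • m₂) h = c • conv m₁ m₂ hm₂ := by
  ext f
  simp only [conv_apply, LinearMap.smul_apply, smul_eq_mul]
  rw [← smul_eq_mul, ← map_smul]
  rfl

/-- The convolution does not depend on the bound supplied for `m₂`. -/
theorem conv_congr_bound (m₁ m₂ : C(X, A) →ₗ[A] A) {C₂ C₂' : ℝ}
    (hm₂ : ∀ φ : C(X, A), ‖m₂ φ‖ ≤ C₂ * ‖φ‖) (hm₂' : ∀ φ : C(X, A), ‖m₂ φ‖ ≤ C₂' * ‖φ‖) :
    conv m₁ m₂ hm₂ = conv m₁ m₂ hm₂' := rfl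

end Assoc

section Comm

variable {X : Type u} [NormedAddCommGroup X] [CompactSpace X] [T2Space X] [TotallyDisconnectedSpace X]
  (P : Presentation.{u, v} X) [∀ k, AddCommGroup (P.F k)]
  {A : Type*} [NormedCommRing A]

/-- COMMUTATIVITY of the convolution, through the coordinates (the Fubini step of the model):
`coord (m₁ ∗ m₂) = levelMul (coord m₁) (coord m₂) = levelMul (coord m₂) (coord m₁) = coord (m₂ ∗ m₁)`,
and a bounded measure is its coordinates. -/
theorem conv_comm (hq : ∀ (k : ℕ) (x y : X), P.q k (x + y) = P.q k x + P.q k y)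
    (m₁ m₂ : C(X, A) →ₗ[A] A) {C₁ C₂ : ℝ} (hC₁ : 0 ≤ C₁) (hC₂ : 0 ≤ C₂)
    (hm₁ : ∀ φ : C(X, A), ‖m₁ φ‖ ≤ C₁ * ‖φ‖) (hm₂ : ∀ φ : C(X, A), ‖m₂ φ‖ ≤ C₂ * ‖φ‖) :
    conv m₁ m₂ hm₂ = conv m₂ m₁ hm₁ := by
  refine P.eq_of_coord_eq _ _ (C := C₁ * C₂) (mul_nonneg hC₁ hC₂)
    (norm_conv_le m₁ m₂ hC₁ hC₂ hm₁ hm₂)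
    (fun φ => by rw [mul_comm C₁ C₂]; exact norm_conv_le m₂ m₁ hC₂ hC₁ hm₂ hm₁ φ)
    fun k a => ?_
  rw [coord_conv P hq, coord_conv P hq, levelMul_comm]

end Comm

section Ring

variable {X : Type u} [NormedAddCommGroup X] [CompactSpace X] (A : Type*) [NormedCommRing A]

/-- A non-negative bound of a bounded measure, chosen. -/
noncomputable def bnd (m : boundedMeasures X A) : ℝ := (exists_nonneg_bound_of_mem m.2).choose

/-- `0 ≤ bnd m`. -/
theorem bnd_nonneg (m : boundedMeasures X A) : 0 ≤ bnd A m :=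
  (exists_nonneg_bound_of_mem m.2).choose_spec.1

/-- `‖m φ‖ ≤ bnd m * ‖φ‖`. -/
theorem norm_le_bnd (m : boundedMeasures X A) (φ : C(X, A)) : ‖m.1 φ‖ ≤ bnd A m * ‖φ‖ :=
  (exists_nonneg_bound_of_mem m.2).choose_spec.2 φ

/-- The convolution of two bounded measures, as a bounded measure. -/
noncomputable def mul (m₁ m₂ : boundedMeasures X A) : boundedMeasures X A :=
  ⟨conv m₁.1 m₂.1 (norm_le_bnd A m₂), _, norm_conv_le m₁.1 m₂.1 (bnd_nonneg A m₁) (bnd_nonneg A m₂)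
    (norm_le_bnd A m₁) (norm_le_bnd A m₂)⟩

/-- `(mul m₁ m₂).1 = conv m₁ m₂`. -/
theorem mul_coe (m₁ m₂ : boundedMeasures X A) :
    (mul A m₁ m₂ : C(X, A) →ₗ[A] A) = conv m₁.1 m₂.1 (norm_le_bnd A m₂) := rfl

variable (X) in
/-- The point mass `δ_0`, as a bounded measure. -/
noncomputable def one : boundedMeasures X A := ⟨dirac 0, 1, norm_dirac_le 0⟩

/-- `one.1 = dirac 0`. -/
theorem one_coe : ((one X A : boundedMeasures X A) : C(X, A) →ₗ[A] A) = dirac 0 := rfl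

variable {A}
variable [T2Space X] [TotallyDisconnectedSpace X] (P : Presentation.{u, v} X) [∀ k, AddCommGroup (P.F k)]

/-- THE BOUNDED MEASURES ON A PRESENTED COMPACT ABELIAN GROUP FORM A COMMUTATIVE RING under
convolution, with unit `δ_0` (`W[[Γ]]` as a ring, read in the model). -/
@[reducible] noncomputable def convCommRing (hq : ∀ (k : ℕ) (x y : X), P.q k (x + y) = P.q k x + P.q k y) :
    CommRing (boundedMeasures X A) :=
  { (inferInstance : AddCommGroup (boundedMeasures X A)) with
    mul := mul A
    one := one X A
    mul_assoc := fun m₁ m₂ m₃ =>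
      Subtype.ext (conv_assoc m₁.1 m₂.1 m₃.1 (bnd_nonneg A m₂) (bnd_nonneg A m₃) (norm_le_bnd A m₂)
        (norm_le_bnd A m₃))
    one_mul := fun m => Subtype.ext (conv_dirac_zero m.1 (norm_le_bnd A m))
    mul_one := fun m => Subtype.ext (conv_dirac_zero' m.1)
    left_distrib := fun m₁ m₂ m₃ =>
      Subtype.ext (conv_add_right m₁.1 m₂.1 m₃.1 (norm_le_bnd A m₂) (norm_le_bnd A m₃)
        (norm_le_bnd A (m₂ + m₃)))
    right_distrib := fun m₁ m₂ m₃ => Subtype.ext (conv_add_left m₁.1 m₂.1 m₃.1 (norm_le_bnd A m₃))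
    zero_mul := fun m => Subtype.ext (by
      ext f
      rfl)
    mul_zero := fun m => Subtype.ext (by
      ext f
      change m.1 (partialIntegral (0 : C(X, A) →ₗ[A] A) (norm_le_bnd A 0) f) = 0
      rw [show partialIntegral (0 : C(X, A) →ₗ[A] A) (norm_le_bnd A 0) f = 0 from rfl, map_zero])
    mul_comm := fun m₁ m₂ =>
      Subtype.ext (conv_comm P hq m₁.1 m₂.1 (bnd_nonneg A m₁) (bnd_nonneg A m₂) (norm_le_bnd A m₁)
        (norm_le_bnd A m₂)) }

/-- In the ring `convCommRing`, the product is the convolution. -/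
theorem convCommRing_mul_coe (hq : ∀ (k : ℕ) (x y : X), P.q k (x + y) = P.q k x + P.q k y)
    (m₁ m₂ : boundedMeasures X A) :
    letI := convCommRing P (A := A) hq
    ((m₁ * m₂ : boundedMeasures X A) : C(X, A) →ₗ[A] A) = conv m₁.1 m₂.1 (norm_le_bnd A m₂) := rfl

/-- THE COORDINATES ARE MULTIPLICATIVE: `coord (m₁ ∗ m₂) = levelMul (coord m₁) (coord m₂)` on the
ring — `coord` is a ring homomorphism from the measures to the level-wise group rings. -/
theorem coord_mul (hq : ∀ (k : ℕ) (x y : X), P.q k (x + y) = P.q k x + P.q k y)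
    (m₁ m₂ : boundedMeasures X A) :
    letI := convCommRing P (A := A) hq
    P.coord ((m₁ * m₂ : boundedMeasures X A) : C(X, A) →ₗ[A] A) =
      levelMul P A (P.coord m₁.1) (P.coord m₂.1) := by
  rw [convCommRing_mul_coe, coord_conv P hq]

/-- The coordinates of the unit are the system `[0]`. -/
theorem coord_one (hq : ∀ (k : ℕ) (x y : X), P.q k (x + y) = P.q k x + P.q k y) :
    letI := convCommRing P (A := A) hq
    P.coord ((1 : boundedMeasures X A) : C(X, A) →ₗ[A] A) =
      fun k a => if P.q k 0 = a then 1 else 0 :=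
  funext fun k => coord_dirac_eq P 0 k

end Ring

section Product

variable (p : ℕ) [Fact (Nat.Prime p)] (ι : Type*) [Fintype ι] [DecidableEq ι]
  (A : Type*) [NormedCommRing A]

/-- `W[[Γ⁻]]` AS A RING for `Γ⁻ ≅ ℤ_p^ι`: the bounded `A`-valued measures on `ℤ_p^ι` with
convolution, unit `δ_0`, whose coordinates on the `(ℤ/p^k)^ι` multiply level-wise. -/
@[reducible] noncomputable def convCommRing_product : CommRing (boundedMeasures (ι → ℤ_[p]) A) :=
  convCommRing (padicProductPresentation p ι) (padicProductPresentation_q_add p ι)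

end Product

/-! ## The μ-invariant and the convolution: `μ(m₁ ∗ m₂) ≥ μ(m₁) + μ(m₂)`, `μ(δ_x) = 0` -/
variable {X : Type u} [NormedAddCommGroup X] [CompactSpace X]
variable {A : Type*} [NormedCommRing A] [IsDomain A] [IsDiscreteValuationRing A]

omit [CompactSpace X] in
/-- `μ(δ_x) = 0`: the point mass takes the value `1` on the clopen set `X`. -/
theorem muV_dirac (x : X) : muV (dirac x : C(X, A) →ₗ[A] A) = 0 := by
  refine le_antisymm ?_ bot_le
  have h := muV_le (dirac x : C(X, A) →ₗ[A] A) isClopen_univ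
  rw [dirac_apply, indicatorCM_apply isClopen_univ, Set.indicator_univ, Pi.one_apply,
    AddValuation.map_one] at h
  exact h

variable (P : Presentation.{u, v} X) [∀ k, AddCommGroup (P.F k)]

/-- `μ(m₁) + μ(m₂) ≤ μ(m₁ ∗ m₂)`: the coordinates of the convolution are the level-wise group-ring
products `Σ_a coord m₁ k a · coord m₂ k (c − a)`, each term of valuation `≥ μ(m₁) + μ(m₂)`, and
the valuation of a sum is at least the minimum. -/
theorem muV_conv_ge (hq : ∀ (k : ℕ) (x y : X), P.q k (x + y) = P.q k x + P.q k y)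
    (m₁ m₂ : C(X, A) →ₗ[A] A) {C₂ : ℝ} (hm₂ : ∀ φ : C(X, A), ‖m₂ φ‖ ≤ C₂ * ‖φ‖) :
    muV m₁ + muV m₂ ≤ muV (conv m₁ m₂ hm₂) := by
  rw [P.muV_eq_iInf_coord (conv m₁ m₂ hm₂)]
  refine le_iInf fun k => le_iInf fun c => ?_
  rw [coord_conv P hq, levelMul_apply]
  refine AddValuation.map_le_sum _ fun a _ => ?_
  rw [AddValuation.map_mul]
  refine add_le_add ?_ ?_
  · rw [P.muV_eq_iInf_coord m₁]
    exact (iInf_le (fun k : ℕ => ⨅ a : P.F k, addVal A (P.coord m₁ k a)) k).trans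
      (iInf_le (fun a : P.F k => addVal A (P.coord m₁ k a)) a)
  · rw [P.muV_eq_iInf_coord m₂]
    exact (iInf_le (fun k : ℕ => ⨅ a : P.F k, addVal A (P.coord m₂ k a)) k).trans
      (iInf_le (fun a : P.F k => addVal A (P.coord m₂ k a)) (c - a))

omit [IsDomain A] [IsDiscreteValuationRing A] in
/-- The translate `δ_x ∗ m` of `m` evaluates `f` at `f(x + ·)`. -/
theorem conv_dirac_apply (x : X) (m : C(X, A) →ₗ[A] A) {C : ℝ}
    (hm : ∀ φ : C(X, A), ‖m φ‖ ≤ C * ‖φ‖) (f : C(X, A)) :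
    conv (dirac x) m hm f = m (shift x f) := by
  rw [conv_apply, dirac_apply, partialIntegral_apply]

omit [IsDomain A] [IsDiscreteValuationRing A] in
/-- The coordinates of the translate `δ_x ∗ m` are the coordinates of `m` shifted by `q k x`. -/
theorem coord_conv_dirac (hq : ∀ (k : ℕ) (x y : X), P.q k (x + y) = P.q k x + P.q k y) (x : X)
    (m : C(X, A) →ₗ[A] A) {C : ℝ} (hm : ∀ φ : C(X, A), ‖m φ‖ ≤ C * ‖φ‖) (k : ℕ) (c : P.F k) :
    P.coord (conv (dirac x) m hm) k c = P.coord m k (c - P.q k x) := by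
  rw [Presentation.coord_apply, conv_dirac_apply, shift_indicatorCM_fiber P hq,
    Presentation.coord_apply]

/-- `μ(δ_x ∗ m) = μ(m)`: translation permutes the coordinates of every level. -/
theorem muV_conv_dirac (hq : ∀ (k : ℕ) (x y : X), P.q k (x + y) = P.q k x + P.q k y) (x : X)
    (m : C(X, A) →ₗ[A] A) {C : ℝ} (hm : ∀ φ : C(X, A), ‖m φ‖ ≤ C * ‖φ‖) :
    muV (conv (dirac x) m hm) = muV m := by
  rw [P.muV_eq_iInf_coord (conv (dirac x) m hm), P.muV_eq_iInf_coord m]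
  refine iInf_congr fun k => ?_
  simp only [coord_conv_dirac P hq x m hm]
  exact Equiv.iInf_congr (Equiv.subRight (P.q k x)) fun c => by simp

end Summit.Ventures.HodgeRepro2.T5ProfiniteDistributionAlgebra
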